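import Summits.Ventures.YMGap.Thresholds.StarWindow
import HarnessLib

/-!
# Venture YMGap — track (c) «DS»: the VERTEX-STAR WINDOW KERNEL made explicit
# (brick B1, part 1/2, of the cell's Lean K-row «SC-a for SU(2), d = 4 at β_W ≤ 1/3», PLAN R95/R96)

HONEST FRAMING: venture file (cell `pub-ymgap`), strong-coupling LATTICE bookkeeping only. This file
is PLUMBING for the star door `DSWindow.su2Star_abs_covariance_le` (`StarWindow.lean`): it makes the
window kernel `γ_Λ(· | ω) = torusWeightSpec v Λ ω` of a plaquette-weight lattice gauge specification
explicit for the window `Λ = vertexStar s` (the `2d` links having the site `s` as an endpoint), on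
every torus `(ℤ/L)^d`, for every compact group `G` and every continuous plaquette weight `v`.
Nothing is estimated here: no influence array, no value of `β`, no clustering, continuum or
mass-gap claim. The analytic half of the K-row (the cell's Lemma G, GAUGE-STAR.md §3′: Haar
disintegration of the gauge-fixed star, the 7-link Dobrushin comparison) is NOT in this file
(bricks B2–B4, seats ds-4/ds-2); the gauge half of B1 is `StarGaugeReduction.lean`.

## Contents (all kernel theorems; `s` a site, `Λ⋆ = vertexStar s`)
* `starPlaqs s` — the plaquettes having a link in `Λ⋆` (equivalently: having `s` as a corner);
  `starBoundary s` — their links NOT in `Λ⋆` (for `d = 4`, `L ≥ 3`: `24` plaquettes, `48` links);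
  `torusNorm_le_one_of_mem_starBoundary` — both endpoints of a boundary link are at periodic
  sup-distance `≤ 1` from `s` (the support condition `hKloc` of the star door).
* (i-a) NO ONE-BODY TERMS: `filter_mem_vertexStar_plaqEdgesT` — on a torus of side `≥ 2`, a star
  plaquette contains EXACTLY two star links (the two edges of the plaquette at its corner `s`;
  `filter_mem_vertexStar_plaqEdgesT_corners` lists them corner by corner): the star energy is a sum
  of PAIR terms, each star plaquette coupling two star links to two boundary links.
* THE STAR KERNEL EXPLICIT: `starLogWeight v s U = Σ_{q ∈ starPlaqs s} log v(U_q)`;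
  `torusLogWeight_glueWith_vertexStar` (the torus energy of `ζ ω_{Λ⋆ᶜ}` = star energy + a term
  independent of the inside datum `ζ`); `torusWeightSpec_vertexStar_eq` — `γ_{Λ⋆}(· | ω)` IS the
  product Haar measure on the star links, glued with `ω`, tilted by the STAR energy only;
  `integral_torusWeightSpec_vertexStar` / `specAvg_vertexStar_eq` (the same as integral formulas).
* (i-b) BOUNDARY DEPENDENCE: `torusWeightSpec_congr` (the kernel ignores `ω` on `Λ`, any `Λ`);
  `dependsOn_specAvg_vertexStar` — `ω ↦ γ_{Λ⋆}(f | ω)` reads only the links of `starBoundary s`;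
  `specAvg_vertexStar_eq_of_not_mem` — changing `ω` at one link outside `starBoundary s` does not
  change `γ_{Λ⋆}(f | ω)` (so the window array of (H1) may vanish there).

References: E. Seiler, LNP 159 (1982) Ch. 2; H.-O. Georgii, Gibbs Measures and Phase Transitions
(2011) Def. 2.9; cell `pub-ymgap` ds/engine/gauge/GAUGE-STAR.md §1–§2, §3′ (Lemma G), PLAN R95.
-/

noncomputable section

open MeasureTheory ProbabilityTheory Function Finset
open Literature.Probability.LatticeModels
open Literature.MathematicalPhysics.QuantumFieldTheory
open Literature.MathematicalPhysics.QuantumFieldTheory.Balaban1983to89.StrongCouplingTorusWindow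
  (specAvg specAvg_torusWeightSpec_eq plaqClosure dependsOn_specAvg_torusWeightSpec)
open Summit.Ventures.YMGap.DSWindow

namespace Summit.Ventures.YMGap.StarKernel

variable {d L : ℕ} [NeZero L]

/-! ### Star plaquettes and the star boundary -/

section Plaquettes

/-- The **star plaquettes** of the site `s`: the plaquettes having a link with endpoint `s`
(equivalently, having `s` as a corner). For `d = 4` and `L ≥ 3` there are `24` of them. -/
def starPlaqs (s : Site d L) : Finset (Plaquette d L) :=
  univ.filter fun q => ∃ e ∈ plaqEdgesT q, s ∈ linkEnds e

/-- Membership in `starPlaqs`: some edge of the plaquette lies in the vertex star. -/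
theorem mem_starPlaqs {s : Site d L} {q : Plaquette d L} :
    q ∈ starPlaqs s ↔ ∃ e ∈ plaqEdgesT q, e ∈ vertexStar s := by
  simp only [starPlaqs, mem_filter, mem_univ, true_and, mem_vertexStar]

/-- A plaquette off the star has no star link. -/
theorem not_mem_vertexStar_of_not_mem_starPlaqs {s : Site d L} {q : Plaquette d L}
    (hq : q ∉ starPlaqs s) {e : Edge d L} (he : e ∈ plaqEdgesT q) : e ∉ vertexStar s :=
  fun h => hq (mem_starPlaqs.2 ⟨e, he, h⟩)

/-- The **star boundary** of `s`: the links of the star plaquettes that are not star links (for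
`d = 4`, `L ≥ 3`: the `48` outside links of the `24` star plaquettes, two each). The star kernel
reads the exterior configuration only here (`dependsOn_specAvg_vertexStar`). -/
def starBoundary (s : Site d L) : Finset (Edge d L) :=
  (starPlaqs s).biUnion plaqEdgesT \ vertexStar s

/-- Membership in the star boundary. -/
theorem mem_starBoundary {s : Site d L} {y : Edge d L} :
    y ∈ starBoundary s ↔ (∃ q ∈ starPlaqs s, y ∈ plaqEdgesT q) ∧ y ∉ vertexStar s := by
  simp only [starBoundary, mem_sdiff, mem_biUnion]

/-- **Support condition.** Both endpoints of a star-boundary link are at periodic sup-distance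
`≤ 1` from the star's vertex (the link and a star link lie on a common plaquette): `hKloc` of the
star door holds for any array supported on the star boundary. -/
theorem torusNorm_le_one_of_mem_starBoundary {s : Site d L} {y : Edge d L}
    (hy : y ∈ starBoundary s) {w : Site d L} (hw : w ∈ linkEnds y) : torusNorm (s - w) ≤ 1 := by
  obtain ⟨⟨q, hq, hyq⟩, -⟩ := mem_starBoundary.1 hy
  obtain ⟨e, he, hes⟩ := mem_starPlaqs.1 hq
  exact torusNorm_linkEnds_sub_le_one he hyq (mem_vertexStar.1 hes) hw

/-- The plaquette closure of the vertex star lies in the star together with its boundary. -/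
theorem plaqClosure_vertexStar_subset (s : Site d L) :
    plaqClosure (vertexStar s) ⊆ vertexStar s ∪ starBoundary s := by
  intro z hz
  rw [mem_union]
  by_cases hzs : z ∈ vertexStar s
  · exact Or.inl hzs
  · right
    rw [plaqClosure, mem_union] at hz
    rcases hz with hz | hz
    · exact absurd hz hzs
    · obtain ⟨e, he, hz⟩ := mem_biUnion.1 hz
      obtain ⟨q, hq, hzq⟩ := mem_biUnion.1 hz
      exact mem_starBoundary.2 ⟨⟨q, mem_starPlaqs.2 ⟨e, mem_plaqsThrough.1 hq, he⟩, hzq⟩, hzs⟩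

omit [NeZero L] in
/-- On a torus of side `≥ 2`: `x + e_i ≠ x`, `x + e_i + e_j ≠ x` and `x + e_i ≠ x + e_j` for
`i ≠ j` (read the `i`-th coordinate: `(1 : ZMod L) ≠ 0`). -/
theorem shift_ne (hL : 1 < L) (x : Site d L) {i j : Fin d} (hij : i ≠ j) :
    x.shift i ≠ x ∧ (x.shift i).shift j ≠ x ∧ x.shift i ≠ x.shift j := by
  haveI : Fact (1 < L) := ⟨hL⟩
  refine ⟨fun h => ?_, fun h => ?_, fun h => ?_⟩
  all_goals
    have h1 := congr_fun h i
    simp only [Literature.MathematicalPhysics.QuantumFieldTheory.Site.shift, Pi.add_apply,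
      Pi.single_apply, if_neg hij, add_zero, add_eq_left] at h1
    exact one_ne_zero h1

omit [NeZero L] in
/-- The four edges of the plaquette at `x` in the plane `(i, j)`, spelled out. -/
theorem mem_plaqEdgesT_mk {x : Site d L} {i j : Fin d} (hij : i < j) {e : Edge d L} :
    e ∈ plaqEdgesT ((x, ⟨(i, j), hij⟩) : Plaquette d L) ↔
      e = (x, i) ∨ e = (x.shift i, j) ∨ e = (x.shift j, i) ∨ e = (x, j) := by
  simp only [plaqEdgesT, mem_insert, mem_singleton]

/-- Corner bookkeeping for (i-a): the star links of the plaquette `(x; i, j)` through each of its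
four corners, on a torus of side `≥ 2`. -/
theorem filter_mem_vertexStar_plaqEdgesT_corners (hL : 1 < L) (x : Site d L) {i j : Fin d}
    (hij : i < j) :
    (plaqEdgesT ((x, ⟨(i, j), hij⟩) : Plaquette d L)).filter (fun e => e ∈ vertexStar x) =
      {(x, i), (x, j)} ∧
    (plaqEdgesT ((x, ⟨(i, j), hij⟩) : Plaquette d L)).filter (fun e => e ∈ vertexStar (x.shift i)) =
      {(x, i), (x.shift i, j)} ∧
    (plaqEdgesT ((x, ⟨(i, j), hij⟩) : Plaquette d L)).filter (fun e => e ∈ vertexStar (x.shift j)) =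
      {(x.shift j, i), (x, j)} ∧
    (plaqEdgesT ((x, ⟨(i, j), hij⟩) : Plaquette d L)).filter
        (fun e => e ∈ vertexStar ((x.shift i).shift j)) = {(x.shift i, j), (x.shift j, i)} := by
  have hne : i ≠ j := hij.ne
  obtain ⟨hxi, hxij, hij'⟩ := shift_ne hL x hne
  obtain ⟨hxj, hxji, -⟩ := shift_ne hL x hne.symm
  have hcomm : (x.shift i).shift j = (x.shift j).shift i := by
    simp only [Literature.MathematicalPhysics.QuantumFieldTheory.Site.shift, add_assoc,
      add_comm (Pi.single (M := fun _ => ZMod L) i 1)]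
  have hxi_j : (x.shift i).shift j ≠ x.shift i := (shift_ne hL _ hne.symm).1
  have hxj_i : (x.shift j).shift i ≠ x.shift j := (shift_ne hL _ hne).1
  have hxi_ne_xji : x.shift i ≠ (x.shift j).shift i := by rw [← hcomm]; exact hxi_j.symm
  have hxj_ne_xij : x.shift j ≠ (x.shift i).shift j := by rw [hcomm]; exact hxj_i.symm
  refine ⟨?_, ?_, ?_, ?_⟩
  · ext e
    simp only [mem_filter, mem_plaqEdgesT_mk, mem_insert, mem_singleton, mem_vertexStar, mem_linkEnds]
    constructor
    · rintro ⟨h1, h2⟩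
      rcases h1 with rfl | rfl | rfl | rfl
      · exact Or.inl rfl
      · rcases h2 with h | h
        · exact (hxi h.symm).elim
        · exact (hxij h.symm).elim
      · rcases h2 with h | h
        · exact (hxj h.symm).elim
        · exact (hxji h.symm).elim
      · exact Or.inr rfl
    · rintro (rfl | rfl)
      · exact ⟨Or.inl rfl, Or.inl rfl⟩
      · exact ⟨Or.inr (Or.inr (Or.inr rfl)), Or.inl rfl⟩
  · ext e
    simp only [mem_filter, mem_plaqEdgesT_mk, mem_insert, mem_singleton, mem_vertexStar, mem_linkEnds]
    constructor
    · rintro ⟨h1, h2⟩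
      rcases h1 with rfl | rfl | rfl | rfl
      · exact Or.inl rfl
      · exact Or.inr rfl
      · rcases h2 with h | h
        · exact (hij' h).elim
        · exact (hxi_ne_xji h).elim
      · rcases h2 with h | h
        · exact (hxi h).elim
        · exact (hij' h).elim
    · rintro (rfl | rfl)
      · exact ⟨Or.inl rfl, Or.inr rfl⟩
      · exact ⟨Or.inr (Or.inl rfl), Or.inl rfl⟩
  · ext e
    simp only [mem_filter, mem_plaqEdgesT_mk, mem_insert, mem_singleton, mem_vertexStar, mem_linkEnds]
    constructor
    · rintro ⟨h1, h2⟩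
      rcases h1 with rfl | rfl | rfl | rfl
      · rcases h2 with h | h
        · exact (hxj h).elim
        · exact (hij' h.symm).elim
      · rcases h2 with h | h
        · exact (hij' h.symm).elim
        · exact (hxj_ne_xij h).elim
      · exact Or.inl rfl
      · exact Or.inr rfl
    · rintro (rfl | rfl)
      · exact ⟨Or.inr (Or.inr (Or.inl rfl)), Or.inl rfl⟩
      · exact ⟨Or.inr (Or.inr (Or.inr rfl)), Or.inr rfl⟩
  · ext e
    simp only [mem_filter, mem_plaqEdgesT_mk, mem_insert, mem_singleton, mem_vertexStar, mem_linkEnds]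
    constructor
    · rintro ⟨h1, h2⟩
      rcases h1 with rfl | rfl | rfl | rfl
      · rcases h2 with h | h
        · exact (hxij h).elim
        · exact (hxi_j h).elim
      · exact Or.inl rfl
      · exact Or.inr rfl
      · rcases h2 with h | h
        · exact (hxij h).elim
        · rw [hcomm] at h; exact (hxj_i h).elim
    · rintro (rfl | rfl)
      · exact ⟨Or.inr (Or.inl rfl), Or.inr rfl⟩
      · exact ⟨Or.inr (Or.inr (Or.inl rfl)), Or.inr hcomm⟩

/-- **(i-a) No one-body terms.** On a torus of side `≥ 2`, the star links of a plaquette `q`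
through the vertex `s` are EXACTLY two distinct links (the two edges of `q` at the corner `s`):
every star plaquette couples a PAIR of star links to two boundary links; no plaquette sees a
single star link. -/
theorem filter_mem_vertexStar_plaqEdgesT (hL : 1 < L) {s : Site d L} {q : Plaquette d L}
    (hq : q ∈ starPlaqs s) :
    ∃ a b : Edge d L, a ≠ b ∧ (plaqEdgesT q).filter (fun e => e ∈ vertexStar s) = {a, b} := by
  obtain ⟨x, ⟨⟨i, j⟩, hij⟩⟩ := q
  have hne : i ≠ j := hij.ne
  obtain ⟨h1, h2, h3, h4⟩ := filter_mem_vertexStar_plaqEdgesT_corners hL x hij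
  have hcomm : (x.shift i).shift j = (x.shift j).shift i := by
    simp only [Literature.MathematicalPhysics.QuantumFieldTheory.Site.shift, add_assoc,
      add_comm (Pi.single (M := fun _ => ZMod L) i 1)]
  have n1 : ((x, i) : Edge d L) ≠ (x, j) := fun h => hne (Prod.ext_iff.1 h).2
  have n2 : ((x, i) : Edge d L) ≠ (x.shift i, j) := fun h => hne (Prod.ext_iff.1 h).2
  have n3 : ((x.shift j, i) : Edge d L) ≠ (x, j) := fun h => hne (Prod.ext_iff.1 h).2
  have n4 : ((x.shift i, j) : Edge d L) ≠ (x.shift j, i) := fun h => hne.symm (Prod.ext_iff.1 h).2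
  obtain ⟨e, he, hes⟩ := mem_starPlaqs.1 hq
  rw [mem_vertexStar, mem_linkEnds] at hes
  rcases (mem_plaqEdgesT_mk hij).1 he with rfl | rfl | rfl | rfl <;> rcases hes with rfl | rfl
  · exact ⟨_, _, n1, h1⟩
  · exact ⟨_, _, n2, h2⟩
  · exact ⟨_, _, n2, h2⟩
  · exact ⟨_, _, n4, h4⟩
  · exact ⟨_, _, n3, h3⟩
  · exact ⟨_, _, n4, by rw [← h4, ← hcomm]⟩
  · exact ⟨_, _, n1, h1⟩
  · exact ⟨_, _, n3, h3⟩

end Plaquettes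

/-! ### The star kernel made explicit -/

section Kernel

variable {G : Type*} [Group G] [TopologicalSpace G] [IsTopologicalGroup G] [CompactSpace G]
  [MeasurableSpace G] [BorelSpace G]

/-- The **star energy** (star log-weight) at `s`: `Σ_{q ∈ starPlaqs s} log v(U_q)` — the part of
the torus energy `torusLogWeight v` that sees the star links. -/
def starLogWeight (v : G → ℝ) (s : Site d L) (U : GaugeConfig d L G) : ℝ :=
  ∑ q ∈ starPlaqs s, Real.log (v (plaquetteHolonomy U q.1 q.2.1.1 q.2.1.2))

omit [TopologicalSpace G] [IsTopologicalGroup G] [CompactSpace G] [MeasurableSpace G]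
  [BorelSpace G] in
/-- **Energy split.** The torus energy of the glued configuration `ζ ω_{Λ⋆ᶜ}` is the star energy
plus the energy of the plaquettes off the star, which do not see the inside datum `ζ`. -/
theorem torusLogWeight_glueWith_vertexStar (v : G → ℝ) (s : Site d L) (ω : GaugeConfig d L G)
    (ζ : ↥(vertexStar s) → G) :
    torusLogWeight v (glueWith (vertexStar s) ζ ω) =
      (∑ q ∈ univ \ starPlaqs s, Real.log (v (plaquetteHolonomy ω q.1 q.2.1.1 q.2.1.2))) +
        starLogWeight v s (glueWith (vertexStar s) ζ ω) := by
  unfold torusLogWeight starLogWeight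
  rw [← sum_sdiff (subset_univ (starPlaqs s))]
  congr 1
  refine sum_congr rfl fun q hq => ?_
  have h1 : plaquetteHolonomy (glueWith (vertexStar s) ζ ω) q.1 q.2.1.1 q.2.1.2 =
      plaquetteHolonomy ω q.1 q.2.1.1 q.2.1.2 :=
    dependsOn_plaquetteHolonomy q fun z hz =>
      glueWith_apply_not_mem _ _ _ (not_mem_vertexStar_of_not_mem_starPlaqs (mem_sdiff.1 hq).2 hz)
  rw [h1]

omit [CompactSpace G] in
/-- The star energy of a continuous weight is measurable (second-countable `G`). -/
theorem measurable_starLogWeight [SecondCountableTopology G] {v : G → ℝ} (hv : Continuous v)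
    (s : Site d L) : Measurable (starLogWeight (d := d) (L := L) v s) := by
  unfold starLogWeight
  refine Finset.measurable_sum _ fun q _ => ?_
  exact (hv.measurable.comp (measurable_plaquetteHolonomy _ _ _)).log

omit [MeasurableSpace G] [BorelSpace G] [CompactSpace G] in
/-- The star energy of a continuous positive weight is continuous. -/
theorem continuous_starLogWeight {v : G → ℝ} (hv : Continuous v) (hv0 : ∀ g, 0 < v g)
    (s : Site d L) : Continuous (starLogWeight (d := d) (L := L) v s) := by
  unfold starLogWeight
  refine continuous_finsetSum _ fun q _ => ?_
  exact (hv.comp (Literature.MathematicalPhysics.QuantumLattice.continuous_plaquetteHolonomy _ _ _)).log fun U => (hv0 _).ne'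

omit [MeasurableSpace G] [BorelSpace G] in
/-- The star energy of a continuous positive weight is bounded (compact `G`). -/
theorem exists_abs_starLogWeight_le {v : G → ℝ} (hv : Continuous v) (hv0 : ∀ g, 0 < v g)
    (s : Site d L) : ∃ B, ∀ U : GaugeConfig d L G, |starLogWeight v s U| ≤ B := by
  obtain ⟨C, hC⟩ := isCompact_univ.exists_bound_of_continuousOn
    (continuous_starLogWeight (d := d) (L := L) hv hv0 s).continuousOn
  exact ⟨C, fun U => by simpa [Real.norm_eq_abs] using hC U (Set.mem_univ U)⟩

/-- **The kernel ignores the boundary condition on the window**: if `ω = η` off `Λ`, then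
`γ_Λ(· | ω) = γ_Λ(· | η)` (the glued configurations coincide). -/
theorem torusWeightSpec_congr (v : G → ℝ) (Λ : Finset (Edge d L)) {ω η : GaugeConfig d L G}
    (h : ∀ e, e ∉ Λ → ω e = η e) : torusWeightSpec v Λ ω = torusWeightSpec v Λ η := by
  have hg : (fun ζ : ↥Λ → G => glueWith Λ ζ ω) = fun ζ => glueWith Λ ζ η := by
    funext ζ z
    by_cases hz : z ∈ Λ
    · rw [glueWith_apply_mem _ _ _ hz, glueWith_apply_mem _ _ _ hz]
    · rw [glueWith_apply_not_mem _ _ _ hz, glueWith_apply_not_mem _ _ _ hz, h z hz]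
  unfold torusWeightSpec
  rw [hg]

variable [SecondCountableTopology G]

/-- **THE STAR KERNEL, EXPLICIT.** For a continuous plaquette weight `v`, the window kernel of the
torus weight specification on the vertex star is the product Haar measure on the star links,
glued with `ω` outside, tilted by the STAR energy alone:
`γ_{Λ⋆}(· | ω) = (Haar^{⊗Λ⋆} ∘ glue_ω⁻¹).tilted (Σ_{q ∈ starPlaqs s} log v(U_q))`
(the off-star plaquettes contribute a constant, which cancels in the normalisation:
`tilted_const_add_eq`). -/
theorem torusWeightSpec_vertexStar_eq {v : G → ℝ} (hv : Continuous v) (s : Site d L)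
    (ω : GaugeConfig d L G) :
    torusWeightSpec v (vertexStar s) ω =
      ((Measure.pi fun _ : ↥(vertexStar s) => haarProbability G).map
        (glueWith (vertexStar s) · ω)).tilted (starLogWeight v s) := by
  unfold torusWeightSpec
  rw [← map_tilted_comp _ (measurable_glueWith _ ω) (measurable_torusLogWeight hv),
    ← map_tilted_comp _ (measurable_glueWith _ ω) (measurable_starLogWeight hv s)]
  congr 1
  have hsplit : (torusLogWeight v ∘ fun ζ : ↥(vertexStar s) → G => glueWith (vertexStar s) ζ ω) =
      fun ζ => (∑ q ∈ univ \ starPlaqs s,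
          Real.log (v (plaquetteHolonomy ω q.1 q.2.1.1 q.2.1.2))) +
        (starLogWeight v s ∘ fun ζ : ↥(vertexStar s) → G => glueWith (vertexStar s) ζ ω) ζ :=
    funext fun ζ => torusLogWeight_glueWith_vertexStar v s ω ζ
  rw [hsplit, tilted_const_add_eq]

/-- **The star kernel as an integral formula**: for measurable `f`,
`γ_{Λ⋆}(f | ω) = ∫ f(ζ ω_{Λ⋆ᶜ}) μ_ω(dζ)`, `μ_ω = Haar^{⊗Λ⋆}.tilted (ζ ↦ Σ_{q ∈ starPlaqs s} log v((ζ ω)_q))`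
— only the star plaquettes enter, and `ω` only through their links. -/
theorem integral_torusWeightSpec_vertexStar {v : G → ℝ} (hv : Continuous v) (s : Site d L)
    (ω : GaugeConfig d L G) {f : GaugeConfig d L G → ℝ} (hfm : Measurable f) :
    ∫ U, f U ∂(torusWeightSpec v (vertexStar s) ω) =
      ∫ ζ, f (glueWith (vertexStar s) ζ ω) ∂((Measure.pi fun _ : ↥(vertexStar s) =>
        haarProbability G).tilted fun ζ => starLogWeight v s (glueWith (vertexStar s) ζ ω)) := by
  rw [torusWeightSpec_vertexStar_eq hv s ω,
    ← map_tilted_comp _ (measurable_glueWith _ ω) (measurable_starLogWeight hv s),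
    integral_map (measurable_glueWith _ ω).aemeasurable hfm.aestronglyMeasurable]
  rfl

/-- The smoothing `γ_{Λ⋆} f` in terms of the star kernel (`specAvg_torusWeightSpec_eq` with the
star energy). -/
theorem specAvg_vertexStar_eq {v : G → ℝ} (hv : Continuous v) (s : Site d L)
    {f : GaugeConfig d L G → ℝ} (hfm : Measurable f) (ω : GaugeConfig d L G) :
    specAvg (torusWeightSpec v) (vertexStar s) f ω =
      ∫ ζ, f (glueWith (vertexStar s) ζ ω) ∂((Measure.pi fun _ : ↥(vertexStar s) =>
        haarProbability G).tilted fun ζ => starLogWeight v s (glueWith (vertexStar s) ζ ω)) :=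
  integral_torusWeightSpec_vertexStar hv s ω hfm

/-- **(i-b) The star kernel reads the exterior only on the star boundary**: for `f` measurable
inside the star, `ω ↦ γ_{Λ⋆}(f | ω)` depends only on the links of `starBoundary s`. -/
theorem dependsOn_specAvg_vertexStar {v : G → ℝ} (hv : Continuous v) (s : Site d L)
    {f : GaugeConfig d L G → ℝ} (hfm : Measurable f)
    (hfdep : DependsOn f (↑(vertexStar s) : Set (Edge d L))) :
    DependsOn (specAvg (torusWeightSpec v) (vertexStar s) f) (↑(starBoundary s) : Set (Edge d L)) := by
  intro σ τ h
  have hcl := dependsOn_specAvg_torusWeightSpec hv (vertexStar s) hfm hfdep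
  -- replace `σ` inside the star by `τ`: the kernel does not read the window
  let σ' : GaugeConfig d L G := glueWith (vertexStar s) (fun e => τ e) σ
  have h1 : specAvg (torusWeightSpec v) (vertexStar s) f σ =
      specAvg (torusWeightSpec v) (vertexStar s) f σ' := by
    unfold specAvg
    rw [torusWeightSpec_congr v (vertexStar s) (ω := σ) (η := σ') fun e he =>
      (glueWith_apply_not_mem _ _ _ he).symm]
  rw [h1]
  refine hcl fun z hz => ?_
  by_cases hzs : z ∈ vertexStar s
  · exact glueWith_apply_mem _ _ _ hzs
  · have hzb : z ∈ starBoundary s := by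
      have := plaqClosure_vertexStar_subset s hz
      rw [mem_union] at this
      exact this.resolve_left hzs
    rw [show σ' z = σ z from glueWith_apply_not_mem _ _ _ hzs]
    exact h z hzb

/-- **Changing the exterior at a link off the star boundary does not change the star kernel's
integrals** of observables of the star: the window array of (H1) may be taken to vanish there. -/
theorem specAvg_vertexStar_eq_of_not_mem {v : G → ℝ} (hv : Continuous v) (s : Site d L)
    {f : GaugeConfig d L G → ℝ} (hfm : Measurable f)
    (hfdep : DependsOn f (↑(vertexStar s) : Set (Edge d L))) {y : Edge d L}
    (hy : y ∉ starBoundary s) {ω η : GaugeConfig d L G} (hωη : ∀ e, e ≠ y → ω e = η e) :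
    ∫ U, f U ∂(torusWeightSpec v (vertexStar s) ω) = ∫ U, f U ∂(torusWeightSpec v (vertexStar s) η) :=
  dependsOn_specAvg_vertexStar hv s hfm hfdep fun z hz => hωη z (by rintro rfl; exact hy hz)

end Kernel

end Summit.Ventures.YMGap.StarKernel

end
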